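import Literature.Barriers.ValiantsHypothesis.FullRankMultilinearThm20
import Literature.ModelTheory.FiniteModelTheory.SymmetricCircuitCountingWidthProofs
import Summits.ValiantsHypothesis.ValiantsHypothesis.Theorems.BarrierLeverDefinableEquationsRankTemplate

/-!
# Route BarrierLever — the MODEL axis of crux `DefinableEquations` (stmt-8745) / item
# `SingleSizeEquations` (stmt-8749): THE MIN-PARTITION-RANK (FULL-RANK) METHOD IS AN ALGEBRAICALLY
# NATURAL PROOF IN REGIME `d = n` (val-np-p5 g9)

Raz's partial-derivative-matrix method certifies a lower bound for `g ∈ K[x_1, …, x_{2n}]` from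
FULL RANK: for EVERY balanced partition `Y ⊔ Z` of the variables the `2^n × 2^n` coefficient
matrix `M_{Y,Z}(g)` is nonsingular (`IsFullRank`, Raz–Yehudayoff 2008 §4.2.2; the hypothesis of
the multilinear lower bounds of Raz, Raz–Shpilka–Yehudayoff, Alon–Kumar–Volk).  The class the
method kills is therefore NOT one determinantal variety but the UNION over the `C(2n,n)` balanced
cuts `Y` of the hypersurfaces `{det M_{Y,Yᶜ} = 0}` (FSV's single-matrix meta-method, FSV18 §1,
does not cover it literally).  In the crux's regime — `2n` variables, degree `≤ 2n`,
`N = C(4n,2n) ≥ 4^n` coefficient coordinates — the PRODUCT of all the cut determinants is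
affordable:

  `E_n(c) = ∏_{Y ⊂ [2n], |Y| = n} det ( c_{∏_{k ∈ P ∪ Q} x_k} )_{P ⊆ Y, Q ⊆ Yᶜ}`

has degree `C(2n,n) · 2^n ≤ 2^{3n}`, size `≤ C(2n,n) · (8 (2^n+1)^7 + 1) ≤ 2^{9n+11} ≤ N^5`
(`n ≥ 11`), NO Boolean variables, is a nonzero polynomial (each factor is a determinant of
DISTINCT coordinates) and vanishes at `coeff(g)` for every `g` that is NOT of full rank.

* §1 coordinate determinants indexed by any finite type (the `Fin r` versions are
  `RankTemplate.*`); §2 the coefficient matrix of a cut as an injective coordinate placement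
  (`cutPlace_injective`, `cutMatrix_eq_pdMatrix` — at `coeff(g)` it IS Raz–Yehudayoff's
  `pdMatrix (rename A g)` — `eval_cutDet_eq_zero`; `rank_pdMatrix_eq_of_map_eY_eq`: the rank only
  depends on the set of `Y`-positions, through the tree bridge `AKV.rank_pdMatrix_rename`);
* §3 `exists_fullRankEquation` (the product, with the explicit size/degree bounds), `level_le`,
  **`not_isSuccinctHittingSet_not_isFullRank`** — `{g : ¬ IsFullRank n g}` is NOT a succinct
  hitting set for `Distinguishers ℂ (2n) 5` (`n ≥ 11`): the full-rank method is FSV-natural with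
  `q = 0` — and the technique-class form `not_isSuccinctHittingSet_of_fullRankMethodProves`
  (`FullRankMethodProves ℂ n s` gives natural proofs against `{g : smCircuitSize g ≤ s}`).

The companion file `…FullRankMethodMultilinearCircuits.lean` composes this with the tree theorem
`AlonKumarVolk2020_thm20_holds`: natural proofs against syntactically multilinear circuits of size
`< c n²/log² n`, a superlinear size on the model axis.  What this is NOT: nothing here is a
natural proof against general size-`n²` circuits (the crux, b = 2 OPEN, Chatterjee–Tengse
arXiv:2309.07612 §1.3 dir. 2) and nothing bears on `VP ≠ VNP`; multilinear FORMULAS of all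
polynomial sizes would follow in the same way from Raz's `n^{Ω(log n)}` theorem, which is NOT in
the tree.  No definitions, no named facts; standard axioms.
Refs: Forbes–Shpilka–Volk 2018 Def. 1/3, Thm. 4, §1 (meta-method); Raz–Yehudayoff 2008 §4.2.2;
Alon–Kumar–Volk 2020 §4.
-/

-- `Summit.ValiantsHypothesis.ValiantsHypothesis.…` repeats a component by the D-0017 layout
-- (single-conjunct summit), which the `dupNamespace` linter flags; the name is mandated.
set_option linter.dupNamespace false

noncomputable section

namespace Summit.ValiantsHypothesis.ValiantsHypothesis.Theorems.BarrierLeverDefinableEquations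

open MvPolynomial
open Literature.Computability.AlgebraicComplexity hiding smCircuitSize IsSyntacticallyMultilinear
open Literature.Barriers.ValiantsHypothesis
open Literature.Barriers.ValiantsHypothesis.RazYehudayoff (ind eY eZ eY_apply eZ_apply support_ind
  ind_apply coeff_setMonomial_rename)
open scoped BigOperators

namespace FullRankMethod

/-! ## §1 Coordinate determinants indexed by an arbitrary finite type
(the `Fin r`-indexed versions are `RankTemplate.*`; same two-line proofs) -/

section Generic

variable {ι : Type} [Fintype ι] [DecidableEq ι] {m : ℕ}

/-- Evaluating the coordinate determinant `det (c_{T i j})` at a point gives the determinant of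
the numerical matrix. [folklore] -/
theorem eval_coordDet (T : ι → ι → ↥(degLEMonomials m)) (c : ↥(degLEMonomials m) → ℂ) :
    eval c (Matrix.of fun i j => (X (T i j) : MvPolynomial ↥(degLEMonomials m) ℂ)).det =
      (Matrix.of fun i j => c (T i j)).det := by
  rw [RingHom.map_det]
  congr 1
  ext i j
  simp [RingHom.mapMatrix_apply, Matrix.map_apply]

/-- An injective placement of coordinates gives a NONZERO coordinate determinant (evaluate at the
indicator of the diagonal coordinates). [folklore] -/
theorem coordDet_ne_zero (T : ι → ι → ↥(degLEMonomials m))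
    (hT : Function.Injective (Function.uncurry T)) :
    (Matrix.of fun i j => (X (T i j) : MvPolynomial ↥(degLEMonomials m) ℂ)).det ≠ 0 := by
  classical
  intro h
  set c : ↥(degLEMonomials m) → ℂ := fun μ => if ∃ i, T i i = μ then 1 else 0 with hc
  have hmat : (Matrix.of fun i j => c (T i j)) = 1 := by
    ext i j
    simp only [Matrix.of_apply, Matrix.one_apply, hc]
    by_cases hij : i = j
    · subst hij; simp
    · rw [if_neg hij, if_neg]
      rintro ⟨i', hi'⟩
      have := hT (a₁ := (i', i')) (a₂ := (i, j)) hi'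
      simp only [Prod.mk.injEq] at this
      exact hij (this.1 ▸ this.2)
  have h2 := eval_coordDet T c
  rw [h, map_zero, hmat, Matrix.det_one] at h2
  exact zero_ne_one h2

/-- A coordinate determinant vanishes wherever the numerical matrix is rank deficient. [folklore] -/
theorem eval_coordDet_eq_zero_of_rank_lt (T : ι → ι → ↥(degLEMonomials m))
    (c : ↥(degLEMonomials m) → ℂ) (h : (Matrix.of fun i j => c (T i j)).rank < Fintype.card ι) :
    eval c (Matrix.of fun i j => (X (T i j) : MvPolynomial ↥(degLEMonomials m) ℂ)).det = 0 := by
  rw [eval_coordDet]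
  by_contra hne
  have hu : IsUnit (Matrix.of fun i j => c (T i j)) :=
    (Matrix.isUnit_iff_isUnit_det _).mpr (isUnit_iff_ne_zero.mpr hne)
  have hr := Matrix.rank_of_isUnit _ hu
  omega

/-- Size of a coordinate determinant: `≤ 8 (|ι| + 1)^7` (Berkowitz, tree). [folklore] -/
theorem complexity_coordDet_le (T : ι → ι → ↥(degLEMonomials m)) :
    complexity (Matrix.of fun i j => (X (T i j) : MvPolynomial ↥(degLEMonomials m) ℂ)).det ≤
      8 * (Fintype.card ι + 1) ^ 7 := by
  have h := BarrierLever.NaturalProofsAgainstAllLinearSizes.complexity_det_le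
    (Matrix.of fun i j => (X (T i j) : MvPolynomial ↥(degLEMonomials m) ℂ)) 0
    (fun i j => by rw [Matrix.of_apply, complexity_X_holds])
  simpa using h

/-- Degree of a coordinate determinant: `≤ |ι|`. [folklore] -/
theorem totalDegree_coordDet_le (T : ι → ι → ↥(degLEMonomials m)) :
    (Matrix.of fun i j => (X (T i j) : MvPolynomial ↥(degLEMonomials m) ℂ)).det.totalDegree ≤
      Fintype.card ι :=
  BarrierLever.NaturalProofsAgainstAllLinearSizes.totalDegree_det_le_card
    (Matrix.of fun i j => (X (T i j) : MvPolynomial ↥(degLEMonomials m) ℂ))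
    (fun i j => by rw [Matrix.of_apply, totalDegree_X])

end Generic

/-! ## §2 The coefficient matrix of a balanced cut as a coordinate placement -/

variable {n : ℕ}

/-- The multilinear exponent vector `∏_{k ∈ W} x_k` has degree `|W| ≤ 2n`: it is one of the
crux's coordinates. [folklore] -/
theorem ind_mem_degLEMonomials (W : Finset (Fin (2 * n))) : ind W ∈ degLEMonomials (2 * n) := by
  classical
  show (ind W).degree ≤ 2 * n
  rw [Finsupp.degree_apply, support_ind]
  calc ∑ i ∈ W, ind W i = ∑ i ∈ W, 1 := Finset.sum_congr rfl fun i hi => by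
        rw [ind_apply, if_pos hi]
    _ = W.card := by simp
    _ ≤ Fintype.card (Fin (2 * n)) := Finset.card_le_univ W
    _ = 2 * n := Fintype.card_fin _

/-- The `Z`-positions of a partition are the complement of its `Y`-positions. [folklore] -/
theorem map_eZ_eq_compl (A : Fin (2 * n) ≃ Fin n ⊕ Fin n) :
    Finset.univ.map (eZ A) = (Finset.univ.map (eY A))ᶜ := by
  ext k
  simp only [Finset.mem_map, Finset.mem_univ, true_and, Finset.mem_compl, eY_apply, eZ_apply]
  constructor
  · rintro ⟨z, rfl⟩ ⟨y, hy⟩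
    exact Sum.inl_ne_inr (A.symm.injective hy)
  · intro h
    rcases hk : A k with y | z
    · exact absurd ⟨y, by rw [← hk, Equiv.symm_apply_apply]⟩ h
    · exact ⟨z, by rw [← hk, Equiv.symm_apply_apply]⟩

/-- The `Y`-positions of a partition form a balanced set. [folklore] -/
theorem card_map_eY (A : Fin (2 * n) ≃ Fin n ⊕ Fin n) : (Finset.univ.map (eY A)).card = n := by
  rw [Finset.card_map, Finset.card_univ, Fintype.card_fin]

/-- The rank of the partial derivative matrix only depends on the SET of `Y`-positions.
[cite: RazYehudayoff2008, §4.2.1–4.2.2] -/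
theorem rank_pdMatrix_eq_of_map_eY_eq {A A' : Fin (2 * n) ≃ Fin n ⊕ Fin n}
    (h : Finset.univ.map (eY A) = Finset.univ.map (eY A')) (g : MvPolynomial (Fin (2 * n)) ℂ) :
    (pdMatrix (rename A g)).rank = (pdMatrix (rename A' g)).rank := by
  classical
  rw [AKV.rank_pdMatrix_rename, AKV.rank_pdMatrix_rename, map_eZ_eq_compl, map_eZ_eq_compl, h]

/-- The cut placement `(P, Q) ↦ c_{∏_{P·eY ∪ Q·eZ} x}` of a partition `A` is injective: all
`4^n` entries of the coefficient matrix are DISTINCT coordinates. [folklore] -/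
theorem cutPlace_injective (A : Fin (2 * n) ≃ Fin n ⊕ Fin n) :
    Function.Injective (Function.uncurry fun U T : Finset (Fin n) =>
      (⟨ind (U.map (eY A) ∪ T.map (eZ A)), ind_mem_degLEMonomials _⟩ : ↥(degLEMonomials (2 * n)))) := by
  classical
  rintro ⟨U, T⟩ ⟨U', T'⟩ h
  simp only [Function.uncurry_apply_pair, Subtype.mk.injEq] at h
  have hs : U.map (eY A) ∪ T.map (eZ A) = U'.map (eY A) ∪ T'.map (eZ A) := by
    rw [← support_ind (U.map (eY A) ∪ T.map (eZ A)), h, support_ind]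
  -- intersect with the `Y`-positions, resp. the `Z`-positions
  have hdisj : ∀ V W : Finset (Fin n), Disjoint (V.map (eY A)) (W.map (eZ A)) := by
    intro V W
    rw [Finset.disjoint_left]
    intro k hk hk'
    obtain ⟨y, -, rfl⟩ := Finset.mem_map.1 hk
    obtain ⟨z, -, hz⟩ := Finset.mem_map.1 hk'
    exact Sum.inr_ne_inl (A.symm.injective (hz : A.symm (Sum.inr z) = A.symm (Sum.inl y)))
  have hU : U.map (eY A) = U'.map (eY A) := by
    ext k
    constructor
    · intro hk
      have hk2 : k ∈ U'.map (eY A) ∪ T'.map (eZ A) := hs ▸ Finset.mem_union_left _ hk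
      rcases Finset.mem_union.1 hk2 with h1 | h1
      · exact h1
      · exact absurd h1 (Finset.disjoint_left.1 (hdisj U T') hk)
    · intro hk
      have hk2 : k ∈ U.map (eY A) ∪ T.map (eZ A) := hs.symm ▸ Finset.mem_union_left _ hk
      rcases Finset.mem_union.1 hk2 with h1 | h1
      · exact h1
      · exact absurd h1 (Finset.disjoint_left.1 (hdisj U' T) hk)
  have hT : T.map (eZ A) = T'.map (eZ A) := by
    ext k
    constructor
    · intro hk
      have hk2 : k ∈ U'.map (eY A) ∪ T'.map (eZ A) := hs ▸ Finset.mem_union_right _ hk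
      rcases Finset.mem_union.1 hk2 with h1 | h1
      · exact absurd hk (Finset.disjoint_left.1 (hdisj U' T) h1)
      · exact h1
    · intro hk
      have hk2 : k ∈ U.map (eY A) ∪ T.map (eZ A) := hs.symm ▸ Finset.mem_union_right _ hk
      rcases Finset.mem_union.1 hk2 with h1 | h1
      · exact absurd hk (Finset.disjoint_left.1 (hdisj U T') h1)
      · exact h1
  exact Prod.ext (Finset.map_injective _ hU) (Finset.map_injective _ hT)

/-- At `coeff(g)` the numerical matrix of the cut placement of `A` IS the partial derivative
matrix `M_{g^A}` of Raz–Yehudayoff. [cite: RazYehudayoff2008, §4.2.2] -/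
theorem cutMatrix_eq_pdMatrix (A : Fin (2 * n) ≃ Fin n ⊕ Fin n) (g : MvPolynomial (Fin (2 * n)) ℂ) :
    (Matrix.of fun U T : Finset (Fin n) => coeffVector (degLEMonomials (2 * n)) g
      ⟨ind (U.map (eY A) ∪ T.map (eZ A)), ind_mem_degLEMonomials _⟩) = pdMatrix (rename A g) := by
  ext U T
  rw [Matrix.of_apply, coeffVector_apply, RazYehudayoff.pdMatrix_eq_cM, RazYehudayoff.cM,
    Matrix.of_apply, coeff_setMonomial_rename]

/-- **The cut determinant of `A` vanishes at `coeff(g)` whenever `M_{g^A}` is rank deficient.**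
[cite: RazYehudayoff2008, §4.2.2] -/
theorem eval_cutDet_eq_zero (A : Fin (2 * n) ≃ Fin n ⊕ Fin n) (g : MvPolynomial (Fin (2 * n)) ℂ)
    (h : (pdMatrix (rename A g)).rank ≠ 2 ^ n) :
    eval (coeffVector (degLEMonomials (2 * n)) g)
      (Matrix.of fun U T : Finset (Fin n) => (X (⟨ind (U.map (eY A) ∪ T.map (eZ A)),
        ind_mem_degLEMonomials _⟩ : ↥(degLEMonomials (2 * n))) :
          MvPolynomial ↥(degLEMonomials (2 * n)) ℂ)).det = 0 := by
  classical
  refine eval_coordDet_eq_zero_of_rank_lt _ _ ?_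
  rw [cutMatrix_eq_pdMatrix, Fintype.card_finset, Fintype.card_fin]
  have hle : (pdMatrix (rename A g)).rank ≤ 2 ^ n := by
    have := Matrix.rank_le_card_width (pdMatrix (rename A g))
    rwa [Fintype.card_finset, Fintype.card_fin] at this
  omega

/-! ## §3 The product over all balanced cuts: the full-rank method is FSV-natural -/

/-- **THE FULL-RANK EQUATION.**  For every `n` there is a polynomial `E_n` in the `N = C(4n,2n)`
coefficient coordinates of `ℂ[x_1, …, x_{2n}]^{≤ 2n}` — the product over all `C(2n,n)` balanced
cuts `Y` of the `2^n × 2^n` coordinate determinants `det (c_{∏_{P ∪ Q} x})_{P ⊆ Y, Q ⊆ Yᶜ}` — with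
`E_n ≠ 0`, `L(E_n) ≤ C(2n,n) (8(2^n+1)^7 + 1)`, `deg E_n ≤ C(2n,n) 2^n`, NO Boolean variables, and
`E_n(coeff g) = 0` for every `g` that is NOT of full rank (some balanced partition has
`rank M_{g^A} < 2^n`). [cite: RazYehudayoff2008, §4.2.2] [cite: ForbesShpilkaVolk2018, Def. 1] -/
theorem exists_fullRankEquation (n : ℕ) :
    ∃ E : MvPolynomial ↥(degLEMonomials (2 * n)) ℂ, E ≠ 0 ∧
      complexity E ≤ (2 * n).choose n * (8 * (2 ^ n + 1) ^ 7 + 1) ∧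
      E.totalDegree ≤ (2 * n).choose n * 2 ^ n ∧
      ∀ g : MvPolynomial (Fin (2 * n)) ℂ, ¬ IsFullRank n g →
        eval (coeffVector (degLEMonomials (2 * n)) g) E = 0 := by
  classical
  -- one partition `A Y` for every set of positions `Y` (a balanced one realises `Y` as its `Y`-side)
  have hA : ∀ Y : Finset (Fin (2 * n)), ∃ A : Fin (2 * n) ≃ Fin n ⊕ Fin n,
      Y.card = n → Finset.univ.map (eY A) = Y := by
    intro Y
    by_cases h : Y.card = n
    · obtain ⟨A, hY, -⟩ := AKV.exists_equiv_of_balanced Y h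
      exact ⟨A, fun _ => hY⟩
    · exact ⟨(finCongr (two_mul n)).trans finSumFinEquiv.symm, fun h' => absurd h' h⟩
  choose A hA using hA
  -- the cut determinant of `Y`
  let D : Finset (Fin (2 * n)) → MvPolynomial ↥(degLEMonomials (2 * n)) ℂ := fun Y =>
    (Matrix.of fun U T : Finset (Fin n) => (X (⟨ind (U.map (eY (A Y)) ∪ T.map (eZ (A Y))),
      ind_mem_degLEMonomials _⟩ : ↥(degLEMonomials (2 * n))) :
        MvPolynomial ↥(degLEMonomials (2 * n)) ℂ)).det
  have hcard : (Finset.univ.powersetCard n : Finset (Finset (Fin (2 * n)))).card = (2 * n).choose n := by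
    rw [Finset.card_powersetCard, Finset.card_univ, Fintype.card_fin]
  have h2n : Fintype.card (Finset (Fin n)) = 2 ^ n := by rw [Fintype.card_finset, Fintype.card_fin]
  refine ⟨∏ Y ∈ Finset.univ.powersetCard n, D Y, ?_, ?_, ?_, ?_⟩
  · -- nonzero: a product of determinants of distinct coordinates
    exact Finset.prod_ne_zero_iff.2 fun Y _ => coordDet_ne_zero _ (cutPlace_injective (A Y))
  · -- size: one product gate per cut on top of the `C(2n,n)` determinants
    refine (complexity_finset_prod_le _ _).trans ?_
    rw [hcard, mul_add, mul_one]
    refine Nat.add_le_add_right ?_ _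
    calc ∑ Y ∈ Finset.univ.powersetCard n, complexity (D Y)
        ≤ ∑ _Y ∈ (Finset.univ.powersetCard n : Finset (Finset (Fin (2 * n)))), 8 * (2 ^ n + 1) ^ 7 :=
          Finset.sum_le_sum fun Y _ => (complexity_coordDet_le _).trans (by rw [h2n])
      _ = (2 * n).choose n * (8 * (2 ^ n + 1) ^ 7) := by rw [Finset.sum_const, hcard, smul_eq_mul]
  · -- degree
    refine (totalDegree_finsetProd _ _).trans ?_
    calc ∑ Y ∈ Finset.univ.powersetCard n, (D Y).totalDegree
        ≤ ∑ _Y ∈ (Finset.univ.powersetCard n : Finset (Finset (Fin (2 * n)))), 2 ^ n :=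
          Finset.sum_le_sum fun Y _ => (totalDegree_coordDet_le _).trans (by rw [h2n])
      _ = (2 * n).choose n * 2 ^ n := by rw [Finset.sum_const, hcard, smul_eq_mul]
  · -- vanishing on every non-full-rank `g`: the factor of the deficient cut vanishes
    intro g hg
    unfold IsFullRank at hg
    push Not at hg
    obtain ⟨A₀, hA₀⟩ := hg
    set Y₀ := Finset.univ.map (eY A₀) with hY₀
    have hY₀card : Y₀.card = n := card_map_eY A₀
    have hmem : Y₀ ∈ (Finset.univ.powersetCard n : Finset (Finset (Fin (2 * n)))) :=
      Finset.mem_powersetCard.2 ⟨Finset.subset_univ _, hY₀card⟩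
    rw [map_prod]
    refine Finset.prod_eq_zero hmem ?_
    refine eval_cutDet_eq_zero (A Y₀) g ?_
    rwa [rank_pdMatrix_eq_of_map_eY_eq (hA Y₀ hY₀card)]

/-- Level arithmetic: for `n ≥ 11` both bounds of `exists_fullRankEquation` are `≤ N^5`,
`N = C(4n,2n) ≥ 4^n` (`C(2n,n) (8(2^n+1)^7 + 1) ≤ 2^{9n+11} ≤ 2^{10 n}`). [folklore] -/
theorem level_le (hn : 11 ≤ n) :
    (2 * n).choose n * (8 * (2 ^ n + 1) ^ 7 + 1) ≤ (Nat.choose (2 * (2 * n)) (2 * n)) ^ 5 ∧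
      (2 * n).choose n * 2 ^ n ≤ (Nat.choose (2 * (2 * n)) (2 * n)) ^ 5 := by
  set N := Nat.choose (2 * (2 * n)) (2 * n) with hN
  have h2N : 2 ^ (2 * n) ≤ N :=
    Literature.ModelTheory.FiniteModelTheory.two_pow_le_choose_two_mul_self (2 * n)
  have hN5 : 2 ^ (10 * n) ≤ N ^ 5 := by
    calc 2 ^ (10 * n) = (2 ^ (2 * n)) ^ 5 := by rw [← pow_mul]; ring_nf
      _ ≤ N ^ 5 := Nat.pow_le_pow_left h2N 5
  have hC : (2 * n).choose n ≤ 2 ^ (2 * n) := Nat.choose_le_two_pow _ _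
  have h1 : 2 ^ n + 1 ≤ 2 ^ (n + 1) := by rw [pow_succ]; have := Nat.one_le_two_pow (n := n); omega
  have h7' : (2 ^ n + 1) ^ 7 ≤ 2 ^ (7 * n + 7) := by
    calc (2 ^ n + 1) ^ 7 ≤ (2 ^ (n + 1)) ^ 7 := Nat.pow_le_pow_left h1 7
      _ = 2 ^ (7 * n + 7) := by rw [← pow_mul]; ring_nf
  have hp : 1 ≤ 2 ^ (7 * n + 7) := Nat.one_le_two_pow
  have h7 : 8 * (2 ^ n + 1) ^ 7 + 1 ≤ 2 ^ (7 * n + 11) := by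
    calc 8 * (2 ^ n + 1) ^ 7 + 1 ≤ 8 * 2 ^ (7 * n + 7) + 8 * 2 ^ (7 * n + 7) := by omega
      _ = 2 ^ (7 * n + 7) * 2 ^ 4 := by ring
      _ = 2 ^ (7 * n + 11) := by rw [← pow_add]
  constructor
  · calc (2 * n).choose n * (8 * (2 ^ n + 1) ^ 7 + 1) ≤ 2 ^ (2 * n) * 2 ^ (7 * n + 11) :=
          Nat.mul_le_mul hC h7
      _ = 2 ^ (9 * n + 11) := by rw [← pow_add]; ring_nf
      _ ≤ 2 ^ (10 * n) := Nat.pow_le_pow_right (by norm_num) (by omega)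
      _ ≤ N ^ 5 := hN5
  · calc (2 * n).choose n * 2 ^ n ≤ 2 ^ (2 * n) * 2 ^ n := Nat.mul_le_mul_right _ hC
      _ = 2 ^ (3 * n) := by rw [← pow_add]; ring_nf
      _ ≤ 2 ^ (10 * n) := Nat.pow_le_pow_right (by norm_num) (by omega)
      _ ≤ N ^ 5 := hN5

/-- **THE FULL-RANK (MIN-PARTITION-RANK) METHOD IS AN ALGEBRAICALLY NATURAL PROOF** (regime
`d = n`, level `5`, `q = 0`): for `n ≥ 11` the class of `g ∈ ℂ[x_1, …, x_{2n}]` that are NOT of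
full rank — the class against which Raz's method certifies lower bounds — has an explicit
nonzero equation of size and degree `≤ C(4n,2n)^5`: it is NOT a succinct hitting set for
`Distinguishers ℂ (2n) 5`. [cite: ForbesShpilkaVolk2018, Def. 1 and Thm. 4] [cite: RazYehudayoff2008, §4.2.2] -/
theorem not_isSuccinctHittingSet_not_isFullRank (hn : 11 ≤ n) :
    ¬ IsSuccinctHittingSet (degLEMonomials (2 * n))
        {g : MvPolynomial (Fin (2 * n)) ℂ | ¬ IsFullRank n g} (Distinguishers ℂ (2 * n) 5) := by
  rw [← exists_isNaturalProof_iff]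
  obtain ⟨E, hne, hcomp, hdeg, hvan⟩ := exists_fullRankEquation n
  obtain ⟨hl1, hl2⟩ := level_le hn
  exact ⟨E, ⟨hcomp.trans hl1, hdeg.trans hl2⟩, hne, fun g hg => hvan g hg⟩

/-- **Technique-class form.**  Whatever the full-rank method certifies for syntactically
multilinear circuits (`FullRankMethodProves ℂ n s`: full rank forces `smCircuitSize > s`) is a
natural proof: `{g : smCircuitSize g ≤ s}` is not a succinct hitting set for
`Distinguishers ℂ (2n) 5` (`n ≥ 11`). [cite: AlonKumarVolk2020, §4 (Thm. 20)] [cite: ForbesShpilkaVolk2018, Thm. 4] -/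
theorem not_isSuccinctHittingSet_of_fullRankMethodProves (hn : 11 ≤ n) {s : ℕ}
    (hs : FullRankMethodProves ℂ n s) :
    ¬ IsSuccinctHittingSet (degLEMonomials (2 * n))
        {g : MvPolynomial (Fin (2 * n)) ℂ | smCircuitSize g ≤ (s : ℕ∞)} (Distinguishers ℂ (2 * n) 5) := by
  intro h
  refine not_isSuccinctHittingSet_not_isFullRank hn (h.mono ?_ le_rfl)
  intro g hg hfull
  exact absurd (hs g hfull) (not_lt.2 hg)

end FullRankMethod

end Summit.ValiantsHypothesis.ValiantsHypothesis.Theorems.BarrierLeverDefinableEquations
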